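import Mathlib
import Summits.Ventures.HodgeRepro.Tier4.Line4.SuppMeasure
import Summits.Ventures.HodgeRepro.Tier4.Line4.SuppMeasureFinite
import Summits.Ventures.HodgeRepro.Tier4.Line4.ConvLevelWitness

/-!
# Tier4/Line4/RatioReduce — (S-RATIO) REDUCED: the unfolded support measure sliced along `T_f`, the fibre bound by the
coset count, the lower bound at `γ₀`, and the display narrowed to its `T_f`-projection half

Blind re-derivation cell `pub-hodge-repro`, Tier 4 «prove the step» (README §9–§10), seat t4-L2-p1 (gen 3; (S-RATIO) taken
in the reduction form S15412, plan-4 g5 S15398 (1), lead S15404).  Tree path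
`lean/Summits/Ventures/HodgeRepro/Tier4/Line4/RatioReduce.lean`.  Imports `Line4/SuppMeasure` (p704106) and
`Line4/SuppMeasureFinite` (p704638/p705916), `Line4/ConvLevelWitness` (p706242: `levelDoubleCoset_mul_mem`).  Mathlib-level; no literature.

THE SLICING.  `fibreSet W γ₀ N γ b := {b′ ∈ T′_f : b⁻¹ γ_f b′ ∈ K(N) γ₀,f K(N)}` and `projSet W γ₀ N γ := {b : fibreSet b ≠ ∅}`;
`suppMeasure N γ = ∫⁻_{b ∈ DZ_f} ν′_f(fibreSet b) dν_f` (`Measure.prod_apply`, `suppMeasure_eq_lintegral_fibre`).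
THE FIBRE BOUND.  A left coset `g K(N)` in `G(𝔸_f)` meets `T′_f` in at most one coset of `T′_f ∩ K(N)`; so if the compact
open double coset is covered by `I` left cosets (`reps : Finset`, `levelDoubleCoset ⊆ ⋃_{g ∈ reps} g K(N)`), every fibre has
`ν′_f(fibreSet b) ≤ I · ν′_f(levelTf′ N)` (`measure_fibreSet_le`) and
`suppMeasure N γ ≤ I · ν′_f(levelTf′ N) · ν_f(DZ_f ∩ projSet γ)` (`suppMeasure_le_card_mul`; the outer measure of the
projection, no measurability needed).  Such a finite cover EXISTS (`exists_finset_cover_levelDoubleCoset`: the double coset is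
compact, the cosets open in `G(𝔸_f)`).
THE LOWER BOUND AT `γ₀`.  A non-empty fibre contains a full coset `b′₀ · (T′_f ∩ K(N))` (right stability of the double
coset), so `ν′_f(levelTf′ N) · ν_f(DZ_f ∩ projSet γ₀) ≤ suppMeasure N γ₀` (`suppMeasure_ge_of_proj`; the projection set
measurable as a hypothesis — it is `F_σ`).
THE REDUCTION.  **`suppMeasure_le_of_tProjection`**: with `ν_f(DZ_f ∩ projSet γ) ≤ C″ · ν_f(DZ_f ∩ projSet γ₀)` (the
`T_f`-PROJECTION COMPARISON, the `p`-adic transversality — the display `TProjectionComparisonAlong`, NOT proved here) and the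
coset count `I`, `suppMeasure N γ ≤ (I · C″) · suppMeasure N γ₀` — (S-RATIO) with `C′ := I · C″`.  So (S-RATIO)'s price
is exactly (a) the coset count bounded along `q^n` (the INDEX BOUND) and (b) the projection comparison.

Nothing here says anything about the status of the Hodge conjecture for CM abelian varieties, which is NOT proved
(HC_CM is NOT proved by anyone in this repository).
-/

set_option autoImplicit false
noncomputable section
namespace Summit.Ventures.HodgeRepro.Tier4.Line4
open Summit.Ventures.HodgeRepro.Tier4 Summit.Ventures.HodgeRepro.Tier4.Common
  Summit.Ventures.HodgeRepro.Tier4.Line1 MeasureTheory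
open scoped Topology Pointwise NNReal ENNReal

section Fibre
variable {k : Type} [Field k] [NumberField k] (W : PlaneData k) (γ₀ : GA W) (N : ℕ) (γ : GA W)

/-- **The `b`-fibre of the support set**: `{b′ ∈ T′_f : b⁻¹ γ_f b′ ∈ K(N) γ₀,f K(N)}`. -/
def fibreSet (b : torusFin W) : Set (torusFin' W) :=
  {b' | (((b : torusT W) : GA W))⁻¹ * GA.ofFinPart W γ * ((b' : torusT' W) : GA W) ∈
    levelDoubleCoset W N (GA.ofFinPart W γ₀)}

/-- **The `T_f`-projection of the support set**: the `b` with a non-empty fibre. -/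
def projSet : Set (torusFin W) := {b | (fibreSet W γ₀ N γ b).Nonempty}

/-- The fibre is the slice of `suppSet`. -/
theorem preimage_mk_suppSet (b : torusFin W) : Prod.mk b ⁻¹' suppSet W γ₀ N γ = fibreSet W γ₀ N γ b := rfl

/-- A fibre is closed (`N ≠ 0`). -/
theorem isClosed_fibreSet (hN : N ≠ 0) (b : torusFin W) : IsClosed (fibreSet W γ₀ N γ b) := by
  haveI : T2Space (GA W) := t2Space_GA W
  have hcont : Continuous fun b' : torusFin' W =>
      (((b : torusT W) : GA W))⁻¹ * GA.ofFinPart W γ * ((b' : torusT' W) : GA W) :=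
    continuous_const.mul (continuous_subtype_val.comp continuous_subtype_val)
  exact (isCompact_levelDoubleCoset W hN _).isClosed.preimage hcont

/-- A non-empty fibre contains the coset `b′₀ · (T′_f ∩ K(N))` of any of its points. -/
theorem mul_levelTf'_subset_fibreSet {b : torusFin W} {b' : torusFin' W} (hb' : b' ∈ fibreSet W γ₀ N γ b) :
    (fun c : torusFin' W => b' * c) '' levelTf' W N ⊆ fibreSet W γ₀ N γ b := by
  rintro _ ⟨c, hc, rfl⟩
  show (((b : torusT W) : GA W))⁻¹ * GA.ofFinPart W γ * ((((b' * c : torusFin' W) : torusT' W)) : GA W) ∈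
    levelDoubleCoset W N (GA.ofFinPart W γ₀)
  rw [Subgroup.coe_mul, Subgroup.coe_mul, ← mul_assoc]
  exact levelDoubleCoset_mul_mem W γ₀ N hb' hc

end Fibre

section Slice
variable {k : Type} [Field k] [NumberField k] (W : PlaneData k) [MeasurableSpace (GA W)] [BorelSpace (GA W)]
  (νf : Measure (torusFin W)) (νf' : Measure (torusFin' W)) (γ₀ : GA W) (DZf : Set (torusFin W)) (N : ℕ) (γ : GA W)

/-- **The support measure sliced along `T_f`**: `suppMeasure N γ = ∫⁻_{b ∈ DZ_f} ν′_f(fibreSet b) dν_f`. -/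
theorem suppMeasure_eq_lintegral_fibre [νf.IsHaarMeasure] [νf'.IsHaarMeasure] (hN : N ≠ 0) (hDZf : MeasurableSet DZf) :
    suppMeasure W νf νf' γ₀ DZf N γ = ∫⁻ b in DZf, νf' (fibreSet W γ₀ N γ b) ∂νf := by
  haveI : LocallyCompactSpace (torusFin' W) := locallyCompact_torusFin' W
  haveI : SecondCountableTopology (torusFin' W) := secondCountable_torusFin' W
  haveI : IsLocallyFiniteMeasure νf' := isLocallyFiniteMeasure_of_isFiniteMeasureOnCompacts
  haveI : SigmaFinite νf' := sigmaFinite_of_locallyFinite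
  haveI : BorelSpace (torusT W) := Subtype.borelSpace _
  haveI : BorelSpace (torusT' W) := Subtype.borelSpace _
  haveI : BorelSpace (torusFin W) := Subtype.borelSpace _
  haveI : BorelSpace (torusFin' W) := Subtype.borelSpace _
  have hmeas : MeasurableSet (suppSet W γ₀ N γ ∩ DZf ×ˢ Set.univ) :=
    (measurableSet_suppSet W γ₀ hN γ).inter (hDZf.prod MeasurableSet.univ)
  unfold suppMeasure
  rw [Measure.prod_apply hmeas, ← lintegral_indicator hDZf]
  refine lintegral_congr fun b => ?_
  by_cases hb : b ∈ DZf
  · rw [Set.indicator_of_mem hb]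
    congr 1
    ext b'
    simp only [Set.mem_preimage, Set.mem_inter_iff, Set.mem_prod, Set.mem_univ, and_true, hb]
    rfl
  · rw [Set.indicator_of_notMem hb]
    have : Prod.mk b ⁻¹' (suppSet W γ₀ N γ ∩ DZf ×ˢ Set.univ) = ∅ := by
      ext b'
      simp only [Set.mem_preimage, Set.mem_inter_iff, Set.mem_prod, Set.mem_univ, and_true, hb, and_false,
        Set.mem_empty_iff_false]
    rw [this, measure_empty]

end Slice

section Cover
variable {k : Type} [Field k] [NumberField k] (W : PlaneData k) (γ₀ : GA W) (N : ℕ)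

/-- A left coset `g K(N)` meets `T′_f` in (at most) a single coset of `T′_f ∩ K(N)`: its trace on `T′_f` is
`b′₀ · levelTf′ N` for any `b′₀` in it. -/
theorem trace_coset_eq_mul_levelTf' {g : GA W} {b₀ : torusFin' W}
    (hb₀ : ((b₀ : torusT' W) : GA W) ∈ g • (levelK W N : Set (GA W))) :
    {b' : torusFin' W | ((b' : torusT' W) : GA W) ∈ g • (levelK W N : Set (GA W))} =
      (fun c : torusFin' W => b₀ * c) '' levelTf' W N := by
  obtain ⟨κ₀, hκ₀, hgκ₀⟩ := hb₀
  have hgκ₀' : g * κ₀ = ((b₀ : torusT' W) : GA W) := hgκ₀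
  ext b'
  constructor
  · rintro ⟨κ, hκ, hgκ⟩
    have hgκ' : g * κ = ((b' : torusT' W) : GA W) := hgκ
    refine ⟨b₀⁻¹ * b', ?_, by simp⟩
    show ((((b₀⁻¹ * b' : torusFin' W) : torusT' W)) : GA W) ∈ levelK W N
    simp only [Subgroup.coe_mul, Subgroup.coe_inv]
    rw [← hgκ₀', ← hgκ']
    have : (g * κ₀)⁻¹ * (g * κ) = κ₀⁻¹ * κ := by group
    rw [this]
    exact mul_mem (inv_mem hκ₀) hκ
  · rintro ⟨c, hc, rfl⟩
    refine ⟨κ₀ * ((c : torusT' W) : GA W), mul_mem hκ₀ hc, ?_⟩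
    show g * (κ₀ * ((c : torusT' W) : GA W)) = ((((b₀ * c : torusFin' W) : torusT' W)) : GA W)
    simp only [Subgroup.coe_mul]
    rw [← hgκ₀', mul_assoc]

end Cover

section FibreBound
variable {k : Type} [Field k] [NumberField k] (W : PlaneData k) [MeasurableSpace (GA W)] [BorelSpace (GA W)]
  (νf' : Measure (torusFin' W)) (γ₀ : GA W) (N : ℕ) (γ : GA W)

/-- The trace of a left coset on `T′_f` has measure at most `ν′_f(levelTf′ N)` (Haar: left invariance). -/
theorem measure_trace_coset_le [νf'.IsHaarMeasure] (g : GA W) :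
    νf' {b' : torusFin' W | ((b' : torusT' W) : GA W) ∈ g • (levelK W N : Set (GA W))} ≤ νf' (levelTf' W N) := by
  haveI : BorelSpace (torusT' W) := Subtype.borelSpace _
  haveI : BorelSpace (torusFin' W) := Subtype.borelSpace _
  by_cases h : ∃ b₀ : torusFin' W, ((b₀ : torusT' W) : GA W) ∈ g • (levelK W N : Set (GA W))
  · obtain ⟨b₀, hb₀⟩ := h
    rw [trace_coset_eq_mul_levelTf' W N hb₀]
    have : (fun c : torusFin' W => b₀ * c) '' levelTf' W N = (fun c : torusFin' W => b₀⁻¹ * c) ⁻¹' levelTf' W N := by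
      ext c
      constructor
      · rintro ⟨d, hd, rfl⟩
        simpa using hd
      · intro hc
        exact ⟨b₀⁻¹ * c, hc, by simp⟩
    rw [this, measure_preimage_mul]
  · push Not at h
    have : {b' : torusFin' W | ((b' : torusT' W) : GA W) ∈ g • (levelK W N : Set (GA W))} = ∅ := by
      ext b'
      simp only [Set.mem_setOf_eq, Set.mem_empty_iff_false, iff_false]
      exact h b'
    rw [this, measure_empty]
    exact zero_le

/-- **The fibre bound**: if the double coset is covered by the left cosets of a finite set `reps`, every fibre has measure
at most `reps.card · ν′_f(levelTf′ N)`. -/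
theorem measure_fibreSet_le [νf'.IsHaarMeasure] (reps : Finset (GA W))
    (hcov : levelDoubleCoset W N (GA.ofFinPart W γ₀) ⊆ ⋃ g ∈ reps, g • (levelK W N : Set (GA W)))
    (b : torusFin W) :
    νf' (fibreSet W γ₀ N γ b) ≤ reps.card * νf' (levelTf' W N) := by
  have hsub : fibreSet W γ₀ N γ b ⊆ ⋃ g ∈ reps, {b' : torusFin' W |
      ((b' : torusT' W) : GA W) ∈ ((GA.ofFinPart W γ)⁻¹ * ((b : torusT W) : GA W) * g) •
        (levelK W N : Set (GA W))} := by
    intro b' hb'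
    obtain ⟨g, hg, κ, hκ, hgκ⟩ := Set.mem_iUnion₂.1 (hcov hb')
    refine Set.mem_iUnion₂.2 ⟨g, hg, κ, hκ, ?_⟩
    show (GA.ofFinPart W γ)⁻¹ * ((b : torusT W) : GA W) * g * κ = ((b' : torusT' W) : GA W)
    have h1 : g * κ = (((b : torusT W) : GA W))⁻¹ * GA.ofFinPart W γ * ((b' : torusT' W) : GA W) := hgκ
    calc (GA.ofFinPart W γ)⁻¹ * ((b : torusT W) : GA W) * g * κ
        = (GA.ofFinPart W γ)⁻¹ * ((b : torusT W) : GA W) * (g * κ) := by rw [mul_assoc]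
      _ = (GA.ofFinPart W γ)⁻¹ * ((b : torusT W) : GA W) *
            ((((b : torusT W) : GA W))⁻¹ * GA.ofFinPart W γ * ((b' : torusT' W) : GA W)) := by rw [h1]
      _ = ((b' : torusT' W) : GA W) := by group
  calc νf' (fibreSet W γ₀ N γ b) ≤ νf' (⋃ g ∈ reps, {b' : torusFin' W |
        ((b' : torusT' W) : GA W) ∈ ((GA.ofFinPart W γ)⁻¹ * ((b : torusT W) : GA W) * g) •
          (levelK W N : Set (GA W))}) := measure_mono hsub
    _ ≤ ∑ g ∈ reps, νf' {b' : torusFin' W |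
        ((b' : torusT' W) : GA W) ∈ ((GA.ofFinPart W γ)⁻¹ * ((b : torusT W) : GA W) * g) •
          (levelK W N : Set (GA W))} := measure_biUnion_finset_le _ _
    _ ≤ ∑ _g ∈ reps, νf' (levelTf' W N) :=
        Finset.sum_le_sum fun g _ => measure_trace_coset_le W νf' N _
    _ = reps.card * νf' (levelTf' W N) := by rw [Finset.sum_const, nsmul_eq_mul]

end FibreBound

section Reduce
variable {k : Type} [Field k] [NumberField k] (W : PlaneData k) [MeasurableSpace (GA W)] [BorelSpace (GA W)]
  (νf : Measure (torusFin W)) (νf' : Measure (torusFin' W)) (γ₀ : GA W) (DZf : Set (torusFin W)) (N : ℕ) (γ : GA W)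

/-- **The support measure is bounded by the coset count times the projection's measure**:
`suppMeasure N γ ≤ reps.card · ν′_f(levelTf′ N) · ν_f(DZ_f ∩ projSet γ)` (outer measure of the projection). -/
theorem suppMeasure_le_card_mul [νf.IsHaarMeasure] [νf'.IsHaarMeasure] (hN : N ≠ 0) (hDZf : MeasurableSet DZf)
    (reps : Finset (GA W))
    (hcov : levelDoubleCoset W N (GA.ofFinPart W γ₀) ⊆ ⋃ g ∈ reps, g • (levelK W N : Set (GA W))) :
    suppMeasure W νf νf' γ₀ DZf N γ ≤
      reps.card * νf' (levelTf' W N) * νf (DZf ∩ projSet W γ₀ N γ) := by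
  rw [suppMeasure_eq_lintegral_fibre W νf νf' γ₀ DZf N γ hN hDZf]
  have hpt : ∀ b ∈ DZf, νf' (fibreSet W γ₀ N γ b) ≤
      (DZf ∩ projSet W γ₀ N γ).indicator (fun _ => (reps.card : ℝ≥0∞) * νf' (levelTf' W N)) b := by
    intro b hb
    by_cases hp : b ∈ projSet W γ₀ N γ
    · rw [Set.indicator_of_mem (show b ∈ DZf ∩ projSet W γ₀ N γ from ⟨hb, hp⟩)]
      exact measure_fibreSet_le W νf' γ₀ N γ reps hcov b
    · rw [Set.indicator_of_notMem (fun h => hp h.2)]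
      have : fibreSet W γ₀ N γ b = ∅ := Set.not_nonempty_iff_eq_empty.1 hp
      rw [this, measure_empty]
  calc ∫⁻ b in DZf, νf' (fibreSet W γ₀ N γ b) ∂νf
      ≤ ∫⁻ b in DZf, (DZf ∩ projSet W γ₀ N γ).indicator (fun _ => (reps.card : ℝ≥0∞) * νf' (levelTf' W N)) b ∂νf :=
        setLIntegral_mono' hDZf hpt
    _ ≤ ∫⁻ b, (DZf ∩ projSet W γ₀ N γ).indicator (fun _ => (reps.card : ℝ≥0∞) * νf' (levelTf' W N)) b ∂νf :=
        setLIntegral_le_lintegral _ _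
    _ ≤ (reps.card : ℝ≥0∞) * νf' (levelTf' W N) * νf (DZf ∩ projSet W γ₀ N γ) :=
        lintegral_indicator_const_le _ _

/-- **The lower bound at `γ₀`**: `ν′_f(levelTf′ N) · ν_f(DZ_f ∩ projSet γ₀) ≤ suppMeasure N γ₀` (the projection set
measurable; every non-empty fibre contains a full coset of `T′_f ∩ K(N)`). -/
theorem suppMeasure_ge_of_proj [νf.IsHaarMeasure] [νf'.IsHaarMeasure] (hN : N ≠ 0) (hDZf : MeasurableSet DZf)
    (hproj : MeasurableSet (projSet W γ₀ N γ₀)) :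
    νf' (levelTf' W N) * νf (DZf ∩ projSet W γ₀ N γ₀) ≤ suppMeasure W νf νf' γ₀ DZf N γ₀ := by
  rw [suppMeasure_eq_lintegral_fibre W νf νf' γ₀ DZf N γ₀ hN hDZf]
  haveI : BorelSpace (torusT' W) := Subtype.borelSpace _
  haveI : BorelSpace (torusFin' W) := Subtype.borelSpace _
  have hpt : ∀ b ∈ DZf, (projSet W γ₀ N γ₀).indicator (fun _ => νf' (levelTf' W N)) b ≤
      νf' (fibreSet W γ₀ N γ₀ b) := by
    intro b _
    by_cases hp : b ∈ projSet W γ₀ N γ₀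
    · rw [Set.indicator_of_mem hp]
      have hp' : (fibreSet W γ₀ N γ₀ b).Nonempty := hp
      obtain ⟨b', hb'⟩ := hp'
      have hsub := mul_levelTf'_subset_fibreSet W γ₀ N γ₀ hb'
      have heq : (fun c : torusFin' W => b' * c) '' levelTf' W N =
          (fun c : torusFin' W => b'⁻¹ * c) ⁻¹' levelTf' W N := by
        ext c
        constructor
        · rintro ⟨d, hd, rfl⟩
          simpa using hd
        · intro hc
          exact ⟨b'⁻¹ * c, hc, by simp⟩
      calc νf' (levelTf' W N) = νf' ((fun c : torusFin' W => b'⁻¹ * c) ⁻¹' levelTf' W N) :=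
            (measure_preimage_mul νf' b'⁻¹ _).symm
        _ = νf' ((fun c : torusFin' W => b' * c) '' levelTf' W N) := by rw [heq]
        _ ≤ νf' (fibreSet W γ₀ N γ₀ b) := measure_mono hsub
    · rw [Set.indicator_of_notMem hp]
      exact zero_le
  calc νf' (levelTf' W N) * νf (DZf ∩ projSet W γ₀ N γ₀)
      = ∫⁻ b in DZf, (projSet W γ₀ N γ₀).indicator (fun _ => νf' (levelTf' W N)) b ∂νf := by
        rw [lintegral_indicator_const hproj, Measure.restrict_apply hproj, Set.inter_comm]
    _ ≤ ∫⁻ b in DZf, νf' (fibreSet W γ₀ N γ₀ b) ∂νf := setLIntegral_mono' hDZf hpt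

/-- **(S-RATIO) REDUCED**: from a finite cover of the double coset by `reps.card` left cosets and the `T_f`-PROJECTION
COMPARISON `ν_f(DZ_f ∩ projSet γ) ≤ C″ · ν_f(DZ_f ∩ projSet γ₀)`, `suppMeasure N γ ≤ (reps.card · C″) · suppMeasure N γ₀`. -/
theorem suppMeasure_le_of_tProjection [νf.IsHaarMeasure] [νf'.IsHaarMeasure] (hN : N ≠ 0) (hDZf : MeasurableSet DZf)
    (hproj : MeasurableSet (projSet W γ₀ N γ₀)) (reps : Finset (GA W))
    (hcov : levelDoubleCoset W N (GA.ofFinPart W γ₀) ⊆ ⋃ g ∈ reps, g • (levelK W N : Set (GA W)))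
    (C'' : ℝ≥0∞) (hT : νf (DZf ∩ projSet W γ₀ N γ) ≤ C'' * νf (DZf ∩ projSet W γ₀ N γ₀)) :
    suppMeasure W νf νf' γ₀ DZf N γ ≤ (reps.card * C'') * suppMeasure W νf νf' γ₀ DZf N γ₀ := by
  calc suppMeasure W νf νf' γ₀ DZf N γ
      ≤ reps.card * νf' (levelTf' W N) * νf (DZf ∩ projSet W γ₀ N γ) :=
        suppMeasure_le_card_mul W νf νf' γ₀ DZf N γ hN hDZf reps hcov
    _ ≤ reps.card * νf' (levelTf' W N) * (C'' * νf (DZf ∩ projSet W γ₀ N γ₀)) := by gcongr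
    _ = (reps.card * C'') * (νf' (levelTf' W N) * νf (DZf ∩ projSet W γ₀ N γ₀)) := by ring
    _ ≤ (reps.card * C'') * suppMeasure W νf νf' γ₀ DZf N γ₀ := by
        gcongr
        exact suppMeasure_ge_of_proj W νf νf' γ₀ DZf N hN hDZf hproj

end Reduce

section Display
variable {k : Type} [Field k] [NumberField k] (W : PlaneData k) [MeasurableSpace (GA W)]
  (νf : Measure (torusFin W)) (γ₀ : GA W) (DZf : Set (torusFin W))

/-- **THE `T_f`-PROJECTION COMPARISON (display)** — (S-RATIO)'s residual half after the reduction: along `q^n`, for every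
rational `γ` off the transporter, `ν_f(DZ_f ∩ projSet γ) ≤ C″ · ν_f(DZ_f ∩ projSet γ₀)`.  This is the `p`-adic
transversality: `projSet γ = T_f ∩ γ_f T′_f (K γ₀ K)⁻¹` is the preimage of a `2`-dimensional ball of radius `q^{−n}` in
`T′_f\G_f` under `b ↦ T′_f γ_f⁻¹ b`, which factors through `T_f/Z_f`; the uniformity in `γ` needs the local tori
coordinates and a Jacobian bound — NOT proved here. -/
def TProjectionComparisonAlong (q : ℕ) : Prop :=
  ∃ C'' : ℝ≥0∞, C'' ≠ ⊤ ∧ ∀ (n : ℕ) (γ : rationalPoints W),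
    (torusT W).map (MulAut.conj ((γ : GA W))⁻¹).toMonoidHom ≠ torusT' W →
    νf (DZf ∩ projSet W γ₀ (q ^ n) (γ : GA W)) ≤ C'' * νf (DZf ∩ projSet W γ₀ (q ^ n) γ₀)

end Display

end Summit.Ventures.HodgeRepro.Tier4.Line4

end
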